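import Literature.NumberTheory.Automorphic.UnitaryGroupBlockCentralizer
import Literature.NumberTheory.Automorphic.UnitaryGroupOfFormAdelicTopology
import Literature.NumberTheory.Automorphic.AdelicUnitaryGroupDatum
import Literature.NumberTheory.Rogawski1990.SingularSemisimpleElement
import Mathlib.Topology.Algebra.Group.OpenMapping
import HarnessLib

/-!
# The adelic centraliser of a SINGULAR semisimple rational element of `U(H)`, `H ∈ M₃(L)`, is `U(H_a)(𝔸) × U(H_b)(𝔸)` AS A TOPOLOGICAL
# GROUP (Rogawski 1990, §3.8 Prop. 3.8.1 (a): `G_γ ≅ H′_ξ × E¹`)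

Topic `NumberTheory/Automorphic`; namespace `Literature.NumberTheory.Automorphic.UnitaryGroup`.  THEOREMS ONLY (no definition, no instance,
no named fact, no `sorry`; every isomorphism is delivered as `Nonempty (_ ≃ₜ* _)`).  Sequel of ★ `UnitaryGroupBlockCentralizer` (the
centraliser of a rational block scalar `a·1 ⊕ᶠ b·1` in `U(J₁ ⊕ᶠ J₂)(𝔸)` is the image of ★ `adelicBlockDiag`) and ★
`Rogawski1990.SingularSemisimpleElement` (the frame `γ P = P (a·1₂ ⊕ᶠ b·1₁)`, `ᵗP̄ H P = H_a ⊕ᶠ H_b`).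

* §1 (generic topological groups, `Nonempty` forms) `nonempty_continuousMulEquiv_subgroup_of_eq` (equal subgroups),
  `nonempty_continuousMulEquiv_centralizer_map` (centralisers along a `≃ₜ*`), `nonempty_continuousMulEquiv_prod` (products), and
  **`nonempty_continuousMulEquiv_of_bijective`** — a continuous BIJECTIVE homomorphism from a σ-compact group onto a locally compact
  Hausdorff group is an isomorphism of topological groups (OPEN MAPPING THEOREM, Mathlib `MonoidHom.isOpenMap_of_sigmaCompact`).
* §2 **`nonempty_continuousMulEquiv_centralizer_toAdelic_of_eq_finSum`** — for `a ≠ b` and a rational `δ ∈ U(J₁ ⊕ᶠ J₂)(F)` with matrix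
  `a·1 ⊕ᶠ b·1`: `U(J₁ ⊕ᶠ J₂)(𝔸_F)_{δ ⊗ 1} ≃ₜ* U(J₁)(𝔸_F) × U(J₂)(𝔸_F)` (★ `adelicBlockDiag` is a continuous injective homomorphism
  onto the closed centraliser, §1).
* §3 CM field `L`, `H ∈ M₃(L)` hermitian non-degenerate, `γ ∈ U(H)(L⁺)` SEMISIMPLE, NOT REGULAR, NOT SCALAR:
  **`exists_continuousMulEquiv_centralizer_toAdelic_of_singular`** — there are `a ≠ b` (`āa = b̄b = 1`), `P ∈ GL₃(L)` and hermitian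
  non-degenerate `H_a ∈ M₂(L)`, `H_b ∈ M₁(L)` with `ᵗP̄HP = H_a ⊕ᶠ H_b`, `γP = P(a·1 ⊕ᶠ b·1)`, and
  `Nonempty (↥(centralizer {toAdelic γ}) ≃ₜ* ((cmDatum L 2 H_a).Adelic × (cmDatum L 1 H_b).Adelic))` — the adelic centraliser of `γ`
  in `U(H)(𝔸_{L⁺}) = (cmDatum L 3 H).Adelic` IS `U(H_a)(𝔸_{L⁺}) × U(H_b)(𝔸_{L⁺})`; `…_of_anisotropic` (anisotropic `H`: semisimplicity
  automatic).  This is the input of the unimodularity ∕ orbital-measure statements at the singular classes of the quasi-split `U(Φ₃)`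
  (`U(H_a)(𝔸)` is unimodular by ★ `AdelicUnitaryGroupUnimodularAnisotropic` when `H_a` is anisotropic, by the isotropic rank-2 theorem
  otherwise; `U(H_b)(𝔸)`, rank 1, is commutative).

## References
* J. Rogawski, *Automorphic Representations of Unitary Groups in Three Variables*, Ann. of Math. Stud. 123 (1990), §3.8 Prop. 3.8.1 (a)
  p. 27 [Rogawski1990].
* N. Bourbaki, *Topologie générale*, Chap. IX §5 (open mapping theorem for σ-compact groups) — through Mathlib
  `MonoidHom.isOpenMap_of_sigmaCompact`.
-/

noncomputable section

open scoped MatrixGroups Matrix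
open NumberField Topology

namespace Literature.NumberTheory.Automorphic.UnitaryGroup

/-! ## §1 Generic `≃ₜ*` plumbing (as `Nonempty` statements) -/

section Generic

variable {G G' : Type*} [Group G] [TopologicalSpace G] [Group G'] [TopologicalSpace G']

/-- Equal subgroups are isomorphic topological groups, by the identity of the ambient group. [folklore] -/
private theorem exists_continuousMulEquiv_subgroup_of_eq {H K : Subgroup G} (h : H = K) :
    ∃ e : H ≃ₜ* K, ∀ x : H, ((e x : K) : G) = (x : G) := by
  subst h
  exact ⟨ContinuousMulEquiv.refl H, fun _ => rfl⟩

/-- Centralisers correspond along an isomorphism of topological groups: `C_G(g) ≃ₜ* C_{G'}(e g)`. [folklore] -/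
private theorem nonempty_continuousMulEquiv_centralizer_map [IsTopologicalGroup G] [IsTopologicalGroup G'] (e : G ≃ₜ* G') (g : G) :
    Nonempty (↥(Subgroup.centralizer ({g} : Set G)) ≃ₜ* ↥(Subgroup.centralizer ({e g} : Set G'))) := by
  have hmem : ∀ x : G, x ∈ Subgroup.centralizer ({g} : Set G) ↔ e x ∈ Subgroup.centralizer ({e g} : Set G') := by
    intro x
    rw [Subgroup.mem_centralizer_singleton_iff, Subgroup.mem_centralizer_singleton_iff, ← map_mul, ← map_mul, e.injective.eq_iff]
  exact ⟨{ toFun := fun x => ⟨e (x : G), (hmem (x : G)).1 x.2⟩,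
            invFun := fun y => ⟨e.symm (y : G'), (hmem _).2 (by rw [ContinuousMulEquiv.apply_symm_apply]; exact y.2)⟩,
            left_inv := fun x => Subtype.ext (e.symm_apply_apply (x : G)),
            right_inv := fun y => Subtype.ext (e.apply_symm_apply (y : G')),
            map_mul' := fun x y => Subtype.ext (map_mul e (x : G) (y : G)),
            continuous_toFun := (e.continuous.comp continuous_subtype_val).subtype_mk _,
            continuous_invFun := (e.symm.continuous.comp continuous_subtype_val).subtype_mk _ }⟩

/-- Products of isomorphic topological groups are isomorphic. [folklore] -/
private theorem nonempty_continuousMulEquiv_prod {A A' B B' : Type*} [Group A] [TopologicalSpace A] [Group A'] [TopologicalSpace A']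
    [Group B] [TopologicalSpace B] [Group B'] [TopologicalSpace B'] (eA : A ≃ₜ* A') (eB : B ≃ₜ* B') :
    Nonempty ((A × B) ≃ₜ* (A' × B')) :=
  ⟨{ eA.toMulEquiv.prodCongr eB.toMulEquiv with
      continuous_toFun := (eA.continuous.comp continuous_fst).prodMk (eB.continuous.comp continuous_snd),
      continuous_invFun := (eA.symm.continuous.comp continuous_fst).prodMk (eB.symm.continuous.comp continuous_snd) }⟩

/-- **Open mapping theorem, `≃ₜ*` form**: a continuous bijective homomorphism from a σ-compact topological group onto a locally compact
Hausdorff topological group is an isomorphism of topological groups (Mathlib `MonoidHom.isOpenMap_of_sigmaCompact`). [folklore] -/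
private theorem nonempty_continuousMulEquiv_of_bijective [IsTopologicalGroup G] [SigmaCompactSpace G] [IsTopologicalGroup G']
    [LocallyCompactSpace G'] [T2Space G'] (f : G →* G') (hf : Function.Bijective f) (hc : Continuous f) : Nonempty (G ≃ₜ* G') := by
  have hopen : IsOpenMap f := MonoidHom.isOpenMap_of_sigmaCompact f hf.2 hc
  let e : G ≃ₜ G' := (Equiv.ofBijective f hf).toHomeomorphOfContinuousOpen hc hopen
  exact ⟨{ MulEquiv.ofBijective f hf with continuous_toFun := e.continuous, continuous_invFun := e.symm.continuous }⟩

end Generic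

/-! ## §2 `U(J₁ ⊕ᶠ J₂)(𝔸_F)_{δ ⊗ 1} ≃ₜ* U(J₁)(𝔸_F) × U(J₂)(𝔸_F)` for a rational block scalar `δ` -/

section Adelic

variable (F E : Type) [Field F] [NumberField F] [Field E] [NumberField E] [Algebra F E]
  (c : E ≃ₐ[F] E) (M₁ M₂ : ℕ) (J₁ : Matrix (Fin M₁) (Fin M₁) E) (J₂ : Matrix (Fin M₂) (Fin M₂) E)

omit [NumberField F] in
/-- **The adelic centraliser of a rational block scalar, as a topological group**: for `a ≠ b` in `E` and `δ ∈ U(J₁ ⊕ᶠ J₂)(F)` with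
matrix `a·1 ⊕ᶠ b·1`, the centraliser of `δ ⊗ 1` in `U(J₁ ⊕ᶠ J₂)(𝔸_F)` is isomorphic, as a topological group, to
`U(J₁)(𝔸_F) × U(J₂)(𝔸_F)`: ★ `adelicBlockDiag` is a continuous injective homomorphism with image the centraliser
(★ `centralizer_toAdelic_eq_range_adelicBlockDiag`), and the open-mapping theorem applies (the source is σ-compact, the centraliser is a
closed subgroup of a locally compact group). [cite: Rogawski1990, §3.8 Prop. 3.8.1 p. 27] -/
theorem nonempty_continuousMulEquiv_centralizer_toAdelic_of_eq_finSum {a b : E} (hab : a ≠ b)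
    (δ : rational F E c (M₁ + M₂) (finSum M₁ M₂ J₁ J₂))
    (hδ : ((δ : GL (Fin (M₁ + M₂)) E) : Matrix _ _ E) = finSum M₁ M₂ (a • (1 : Matrix (Fin M₁) (Fin M₁) E)) (b • 1)) :
    Nonempty (↥(Subgroup.centralizer ({toAdelic F E c (M₁ + M₂) (finSum M₁ M₂ J₁ J₂) δ} :
        Set (adelic F E c (M₁ + M₂) (finSum M₁ M₂ J₁ J₂)))) ≃ₜ* (adelic F E c M₁ J₁ × adelic F E c M₂ J₂)) := by
  set C := Subgroup.centralizer ({toAdelic F E c (M₁ + M₂) (finSum M₁ M₂ J₁ J₂) δ} :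
    Set (adelic F E c (M₁ + M₂) (finSum M₁ M₂ J₁ J₂))) with hCdef
  have hrange := centralizer_toAdelic_eq_range_adelicBlockDiag F E c M₁ M₂ J₁ J₂ hab δ hδ
  -- the corestriction of `adelicBlockDiag` to the centraliser
  let f : (adelic F E c M₁ J₁ × adelic F E c M₂ J₂) →* C :=
    (adelicBlockDiag F E c M₁ M₂ J₁ J₂).codRestrict C fun u => by rw [hCdef, hrange]; exact ⟨u, rfl⟩
  have hf : Function.Bijective f := by
    refine ⟨fun u v huv => adelicBlockDiag_injective F E c M₁ M₂ J₁ J₂ (congrArg Subtype.val huv), fun z => ?_⟩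
    have hz : (z : adelic F E c (M₁ + M₂) (finSum M₁ M₂ J₁ J₂)) ∈ (adelicBlockDiag F E c M₁ M₂ J₁ J₂).range := by
      rw [← hrange]; exact z.2
    obtain ⟨u, hu⟩ := hz
    exact ⟨u, Subtype.ext hu⟩
  have hfc : Continuous f := (continuous_adelicBlockDiag F E c M₁ M₂ J₁ J₂).subtype_mk _
  have hCc : IsClosed (C : Set (adelic F E c (M₁ + M₂) (finSum M₁ M₂ J₁ J₂))) := Set.isClosed_centralizer _
  haveI : LocallyCompactSpace C := hCc.isClosedEmbedding_subtypeVal.locallyCompactSpace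
  obtain ⟨e⟩ := nonempty_continuousMulEquiv_of_bijective f hf hfc
  exact ⟨e.symm⟩

end Adelic

/-! ## §3 CM fields: the adelic centraliser of a singular semisimple `γ ∈ U(H)(L⁺)`, `H ∈ M₃(L)` -/

section CM

open Literature.NumberTheory.Rogawski1990
open Literature.AlgebraicGeometry.ShimuraVarieties (unitaryGroup mem_unitaryGroup_iff hermForm)

variable (L : Type) [Field L] [NumberField L] [IsCMField L] (H : Matrix (Fin 3) (Fin 3) L)

/-- `adelic L⁺ L c N J ≃ₜ* (cmDatum L N J).Adelic`, the identity on `GL_N(𝔸_L)` (equal subgroups, ★ `adelic_complexConj`). [folklore] -/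
private theorem exists_continuousMulEquiv_adelic_cmDatum (N : ℕ) (J : Matrix (Fin N) (Fin N) L) :
    ∃ e : ↥(adelic (↥(maximalRealSubfield L)) L (IsCMField.complexConj L) N J) ≃ₜ* (cmDatum L N J).Adelic,
      ∀ x, ((e x).val : GL (Fin N) (AdeleRing (𝓞 L) L)) = (x : GL (Fin N) (AdeleRing (𝓞 L) L)) :=
  exists_continuousMulEquiv_subgroup_of_eq (adelic_complexConj L N J)

/-- **The adelic centraliser of a singular semisimple element is `U(H_a)(𝔸) × U(H_b)(𝔸)`** [Rogawski1990, Prop. 3.8.1 (a)]: for `L` CM,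
`H ∈ M₃(L)` hermitian non-degenerate and `γ ∈ U(H)(L⁺)` SEMISIMPLE, NOT REGULAR and NOT A SCALAR, there are `a ≠ b` with `āa = b̄b = 1`,
`P ∈ GL₃(L)` and hermitian non-degenerate `H_a ∈ M₂(L)`, `H_b ∈ M₁(L)` with `ᵗP̄HP = H_a ⊕ᶠ H_b`, `γ P = P (a·1 ⊕ᶠ b·1)`, such that the
centraliser of `toAdelic γ` in `U(H)(𝔸_{L⁺})` is isomorphic AS A TOPOLOGICAL GROUP to `U(H_a)(𝔸_{L⁺}) × U(H_b)(𝔸_{L⁺})`.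
[cite: Rogawski1990, §3.8 Prop. 3.8.1 p. 27] -/
theorem exists_continuousMulEquiv_centralizer_toAdelic_of_singular (hH : (H.map (cmConjRingHom L))ᵀ = H) (hdet : H.det ≠ 0)
    (γ : (cmDatum L 3 H).Rational) (hss : Rogawski1990.IsSemisimpleElt (cmConjRingHom L) H γ)
    (hnreg : ¬ IsRegularElt (γ.val : GL (Fin 3) L)) (hnsc : ∀ ζ : L, ((γ.val : GL (Fin 3) L) : Matrix (Fin 3) (Fin 3) L) ≠ ζ • 1) :
    ∃ (a b : L) (P : GL (Fin 3) L) (Ha : Matrix (Fin 2) (Fin 2) L) (Hb : Matrix (Fin 1) (Fin 1) L),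
      a ≠ b ∧ cmConjRingHom L a * a = 1 ∧ cmConjRingHom L b * b = 1 ∧
      (((P : Matrix (Fin 3) (Fin 3) L)).map (cmConjRingHom L))ᵀ * H * (P : Matrix (Fin 3) (Fin 3) L) = finSum 2 1 Ha Hb ∧
      ((γ.val : GL (Fin 3) L) : Matrix (Fin 3) (Fin 3) L) * (P : Matrix (Fin 3) (Fin 3) L) =
        (P : Matrix (Fin 3) (Fin 3) L) * finSum 2 1 (a • (1 : Matrix (Fin 2) (Fin 2) L)) (b • (1 : Matrix (Fin 1) (Fin 1) L)) ∧
      (Ha.map (cmConjRingHom L))ᵀ = Ha ∧ (Hb.map (cmConjRingHom L))ᵀ = Hb ∧ Ha.det ≠ 0 ∧ Hb.det ≠ 0 ∧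
      Nonempty (↥(Subgroup.centralizer ({(cmDatum L 3 H).toAdelic γ} : Set (cmDatum L 3 H).Adelic)) ≃ₜ*
        ((cmDatum L 2 Ha).Adelic × (cmDatum L 1 Hb).Adelic)) := by
  have hσ : ∀ x : L, cmConjRingHom L (cmConjRingHom L x) = x := IsCMField.complexConj_apply_apply L
  obtain ⟨a, b, P, Ha, Hb, hab, haa, hbb, hP, hγP, hHa, hHb, hda, hdb⟩ :=
    exists_singular_frame_of_isSemisimpleElt (cmConjRingHom L) hσ H hH hdet γ hss hnreg hnsc
  refine ⟨a, b, P, Ha, Hb, hab, haa, hbb, hP, hγP, hHa, hHb, hda, hdb, ?_⟩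
  -- the block form `H′ = H_a ⊕ᶠ H_b` and the block scalar `δ₀ = P⁻¹ γ P`
  set H' : Matrix (Fin 3) (Fin 3) L := finSum 2 1 Ha Hb with hH'def
  set δ₀ : GL (Fin 3) L := P⁻¹ * (γ.val : GL (Fin 3) L) * P with hδ₀def
  have hδ₀ : (δ₀ : Matrix (Fin 3) (Fin 3) L) = finSum 2 1 (a • (1 : Matrix (Fin 2) (Fin 2) L)) (b • 1) := by
    rw [hδ₀def, Units.val_mul, Units.val_mul, Matrix.mul_assoc, hγP, ← Matrix.mul_assoc, ← Units.val_mul, inv_mul_cancel,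
      Units.val_one, Matrix.one_mul]
  -- `δ₀ ∈ U(H′)(L⁺)`: conjugation by the congruence `P⁻¹`
  have hP' : (((P⁻¹ : GL (Fin 3) L) : Matrix (Fin 3) (Fin 3) L).map (cmConjRingHom L))ᵀ * H' *
      ((P⁻¹ : GL (Fin 3) L) : Matrix (Fin 3) (Fin 3) L) = H := by
    rw [← hP]
    have h1 : (((P⁻¹ : GL (Fin 3) L) : Matrix (Fin 3) (Fin 3) L).map (cmConjRingHom L))ᵀ *
        (((P : Matrix (Fin 3) (Fin 3) L)).map (cmConjRingHom L))ᵀ = 1 := by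
      rw [← Matrix.transpose_mul, ← Matrix.map_mul, ← Units.val_mul, mul_inv_cancel, Units.val_one,
        Matrix.map_one _ (map_zero _) (map_one _), Matrix.transpose_one]
    calc (((P⁻¹ : GL (Fin 3) L) : Matrix (Fin 3) (Fin 3) L).map (cmConjRingHom L))ᵀ *
          ((((P : Matrix (Fin 3) (Fin 3) L)).map (cmConjRingHom L))ᵀ * H * (P : Matrix (Fin 3) (Fin 3) L)) *
          ((P⁻¹ : GL (Fin 3) L) : Matrix (Fin 3) (Fin 3) L)
        = ((((P⁻¹ : GL (Fin 3) L) : Matrix (Fin 3) (Fin 3) L).map (cmConjRingHom L))ᵀ *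
            (((P : Matrix (Fin 3) (Fin 3) L)).map (cmConjRingHom L))ᵀ) * H *
            ((P : Matrix (Fin 3) (Fin 3) L) * ((P⁻¹ : GL (Fin 3) L) : Matrix (Fin 3) (Fin 3) L)) := by
          simp only [Matrix.mul_assoc]
      _ = H := by rw [h1, ← Units.val_mul, mul_inv_cancel, Units.val_one, Matrix.one_mul, Matrix.mul_one]
  have hδ₀mem : δ₀ ∈ unitaryGroup (cmConjRingHom L) H' := by
    have h := conj_mem_unitaryGroup_of_congr (cmConjRingHom L) (P⁻¹) H' H hP' (x := (γ.val : GL (Fin 3) L)) γ.2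
    rwa [inv_inv] at h
  let δ : (cmDatum L 3 H').Rational := ⟨δ₀, hδ₀mem⟩
  -- the same element in the generic currency `rational L⁺ L c (2+1) (Ha ⊕ᶠ Hb)`
  let δ' : rational (↥(maximalRealSubfield L)) L (IsCMField.complexConj L) (2 + 1) (finSum 2 1 Ha Hb) :=
    ⟨δ₀, by rw [rational_complexConj]; exact hδ₀mem⟩
  have hδ' : ((δ' : GL (Fin (2 + 1)) L) : Matrix _ _ L) = finSum 2 1 (a • (1 : Matrix (Fin 2) (Fin 2) L)) (b • 1) := hδ₀
  -- (1) generic currency: `C(toAdelic δ′) ≃ₜ* U(Ha)(𝔸) × U(Hb)(𝔸)`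
  obtain ⟨e₁⟩ := nonempty_continuousMulEquiv_centralizer_toAdelic_of_eq_finSum (↥(maximalRealSubfield L)) L
    (IsCMField.complexConj L) 2 1 Ha Hb hab δ' hδ'
  -- (2) `U(Ha ⊕ᶠ Hb)(𝔸)` in the generic currency `≃ₜ*` `(cmDatum L 3 H′).Adelic`, identity on matrices, `toAdelic δ′ ↦ toAdelic δ`
  obtain ⟨e₂, he₂v⟩ := exists_continuousMulEquiv_adelic_cmDatum L (2 + 1) (finSum 2 1 Ha Hb)
  have he₂ : e₂ (toAdelic (↥(maximalRealSubfield L)) L (IsCMField.complexConj L) (2 + 1) (finSum 2 1 Ha Hb) δ') =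
      (cmDatum L 3 H').toAdelic δ := by
    apply Subtype.ext
    rw [he₂v]
    rfl
  obtain ⟨e₂'⟩ := nonempty_continuousMulEquiv_centralizer_map e₂
    (toAdelic (↥(maximalRealSubfield L)) L (IsCMField.complexConj L) (2 + 1) (finSum 2 1 Ha Hb) δ')
  rw [he₂] at e₂'
  -- (3) the congruence `P`: `(cmDatum L 3 H′).Adelic ≃ₜ* (cmDatum L 3 H).Adelic`, `toAdelic δ ↦ toAdelic γ`
  let e₃ : (cmDatum L 3 H').Adelic ≃ₜ* (cmDatum L 3 H).Adelic :=
    adelicUnitaryGroupCongr L P H H' hP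
  have he₃ : e₃ ((cmDatum L 3 H').toAdelic δ) = (cmDatum L 3 H).toAdelic γ := by
    apply Subtype.ext
    show toAdeleGL L P * toAdeleGL L δ₀ * (toAdeleGL L P)⁻¹ = toAdeleGL L (γ.val : GL (Fin 3) L)
    rw [← map_inv, ← map_mul, ← map_mul, hδ₀def, ← mul_assoc, ← mul_assoc, mul_inv_cancel, one_mul, mul_assoc, mul_inv_cancel, mul_one]
  obtain ⟨e₃'⟩ := nonempty_continuousMulEquiv_centralizer_map e₃ ((cmDatum L 3 H').toAdelic δ)
  rw [he₃] at e₃'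
  -- (4) the factors in the `cmDatum` currency
  obtain ⟨fa, -⟩ := exists_continuousMulEquiv_adelic_cmDatum L 2 Ha
  obtain ⟨fb, -⟩ := exists_continuousMulEquiv_adelic_cmDatum L 1 Hb
  obtain ⟨e₄⟩ := nonempty_continuousMulEquiv_prod fa fb
  exact ⟨e₃'.symm.trans (e₂'.symm.trans (e₁.trans e₄))⟩

/-- **Anisotropic `H`: the adelic centraliser of every NON-REGULAR, NON-SCALAR rational element is `U(H_a)(𝔸) × U(H_b)(𝔸)`**
(semisimplicity is automatic for anisotropic forms, ★ `isSemisimpleElt_of_anisotropic`). [cite: Rogawski1990, §3.8 Prop. 3.8.1 p. 27] -/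
theorem exists_continuousMulEquiv_centralizer_toAdelic_of_anisotropic (hH : (H.map (cmConjRingHom L))ᵀ = H) (hdet : H.det ≠ 0)
    (hanis : ∀ x : Fin 3 → L, hermForm (cmConjRingHom L) H x x = 0 → x = 0)
    (γ : (cmDatum L 3 H).Rational) (hnreg : ¬ IsRegularElt (γ.val : GL (Fin 3) L))
    (hnsc : ∀ ζ : L, ((γ.val : GL (Fin 3) L) : Matrix (Fin 3) (Fin 3) L) ≠ ζ • 1) :
    ∃ (a b : L) (P : GL (Fin 3) L) (Ha : Matrix (Fin 2) (Fin 2) L) (Hb : Matrix (Fin 1) (Fin 1) L),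
      a ≠ b ∧ cmConjRingHom L a * a = 1 ∧ cmConjRingHom L b * b = 1 ∧
      (((P : Matrix (Fin 3) (Fin 3) L)).map (cmConjRingHom L))ᵀ * H * (P : Matrix (Fin 3) (Fin 3) L) = finSum 2 1 Ha Hb ∧
      ((γ.val : GL (Fin 3) L) : Matrix (Fin 3) (Fin 3) L) * (P : Matrix (Fin 3) (Fin 3) L) =
        (P : Matrix (Fin 3) (Fin 3) L) * finSum 2 1 (a • (1 : Matrix (Fin 2) (Fin 2) L)) (b • (1 : Matrix (Fin 1) (Fin 1) L)) ∧
      (Ha.map (cmConjRingHom L))ᵀ = Ha ∧ (Hb.map (cmConjRingHom L))ᵀ = Hb ∧ Ha.det ≠ 0 ∧ Hb.det ≠ 0 ∧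
      Nonempty (↥(Subgroup.centralizer ({(cmDatum L 3 H).toAdelic γ} : Set (cmDatum L 3 H).Adelic)) ≃ₜ*
        ((cmDatum L 2 Ha).Adelic × (cmDatum L 1 Hb).Adelic)) :=
  exists_continuousMulEquiv_centralizer_toAdelic_of_singular L H hH hdet γ
    (isSemisimpleElt_of_anisotropic (cmConjRingHom L) H hanis γ) hnreg hnsc

end CM

end Literature.NumberTheory.Automorphic.UnitaryGroup
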